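import Literature.Geometry.Lorentzian.CoordShrinkerRicciNormSqDrift
import HarnessLib

/-!
# Line `collapsed-ends-usc` of crux `EntropyRung.NoncompactShrinkerGap`: stub `helper_mwRicciNormSqDrift`

Lead c14 of the crux line (item stmt-SmoothPoincare4-10868), programme "Munteanu–Wang 2015,
Thm. 1.4" (a complete four-dimensional gradient shrinker with bounded scalar curvature has bounded
curvature), brick 1 of route item 16588 (splitting at infinity). The registered stub
`helper_mwRicciNormSqDrift` is Munteanu–Wang's inequality (1.10) = (F1), the first line of the
proof of their Lemma 1.2, at chart level: on a normalised gradient shrinker `Ric + Hess f = ½ G`,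

  `Δ_f |Ric|² ≥ 2|∇Ric|² + 2|Ric|² − 4|Rm| |Ric|²`,

i.e. `2 Σ g^{kl}⟨∇_{b_k}Ric, ∇_{b_l}Ric⟩ + 2|Ric|² − 4√(|Rm|²)|Ric|² ≤ Δ|Ric|² − d|Ric|²(♯Df)`. It is
the Literature theorem
`Literature.Geometry.Lorentzian.MetricCoord.IsMetricOn.lapAt_normSqAt_ricAt_sub_fderiv_ge_of_shrinker`
(`CoordShrinkerRicciNormSqDrift.lean`: Hamilton's identity `Δ_f Ric = Ric − 2Rm(Ric)`, the
Bochner formula for `|Ric|²`, metric compatibility of the pairing, and Cauchy–Schwarz in an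
orthonormal frame), specialised to a `Fin 4`-basis; the hypothesis `finrank ℝ E = 4` is not used.

## References

* O. Munteanu, J. Wang, *Geometry of shrinking Ricci solitons*, Compositio Math. 151 (2015)
  = arXiv:1410.3813, Lemma 1.2, (1.10) = (F1). [MunteanuWang2015]
* R. S. Hamilton, J. Differential Geom. 17 (1982), §7, §11 Lemma 11.2. [Hamilton1982]
-/

noncomputable section

-- `Summit.SmoothPoincare4.SmoothPoincare4.…` (summit = problem) trips `dupNamespace` on every decl.
set_option linter.dupNamespace false

open scoped ContDiff Topology
open Set Filter Module
open Literature.Geometry.Lorentzian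

namespace Summit.SmoothPoincare4.SmoothPoincare4.Theorems.NoncompactShrinkerGapMW

/-- **Stub `helper_mwRicciNormSqDrift` (Munteanu–Wang 2015, (1.10) = (F1), PROVED)**: on a
normalised gradient shrinker `Ric + Hess f = ½G` in a chart (metric components `G` on `V`, positive
definite), at `x ∈ V`, in a basis `b` of the four-dimensional model space,
`2|∇Ric|² + 2|Ric|² − 4√(|Rm|²)|Ric|² ≤ Δ|Ric|² − d|Ric|²(♯Df)`.
[cite: MunteanuWang2015, Lemma 1.2 (proof, (F1))] -/
theorem helper_mwRicciNormSqDrift : ∀ {E : Type} [NormedAddCommGroup E] [NormedSpace ℝ E] [FiniteDimensional ℝ E] [CompleteSpace E] (G : E → E →L[ℝ] E →L[ℝ] ℝ) (V : Set E) (x : E) (f : E → ℝ) (b : Module.Basis (Fin 4) ℝ E), MetricCoord.IsMetricOn G V → x ∈ V → Module.finrank ℝ E = 4 → (∀ y ∈ V, ∀ v : E, v ≠ 0 → 0 < G y v v) → ContDiffOn ℝ ∞ f V → (∀ y ∈ V, ∀ v w : E, MetricCoord.ricAt G y v w + MetricCoord.hessAt G f y v w = (1 / 2 : ℝ) * G y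 v w) → 2 * (∑ k, ∑ l, MetricCoord.ginv G b x k l * MetricCoord.pairAt G x (MetricCoord.cov₂At G (MetricCoord.ricAt G) x (b k)) (MetricCoord.cov₂At G (MetricCoord.ricAt G) x (b l))) + 2 * MetricCoord.normSqAt G x (MetricCoord.ricAt G x) - 4 * Real.sqrt (MetricCoord.rmNormSqAt G x) * MetricCoord.normSqAt G x (MetricCoord.ricAt G x) ≤ MetricCoord.lapAt G (fun y ↦ MetricCoord.normSqAt G y (MetricCoord.ricAt G y)) x - fderiv ℝ (fun y ↦ MetricCoord.normSqAt G y (MetricCoord.ricAt G y)) x (MetricCoord.sharpAt G x (fderiv ℝ f x)) := by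
  intro E _ _ _ _ G V x f b hG hx _ hpos hf hsol
  exact hG.lapAt_normSqAt_ricAt_sub_fderiv_ge_of_shrinker b hx (hpos x hx) hf hsol

end Summit.SmoothPoincare4.SmoothPoincare4.Theorems.NoncompactShrinkerGapMW

end
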